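import Literature.AnabelianGeometry.SemiGraphs.PSCUnrShadowEquiv
import Literature.AnabelianGeometry.SemiGraphs.PSCUnrShadowKernel
import Literature.AnabelianGeometry.SemiGraphs.PSCCoveringMapAlongTransfer
import Literature.AnabelianGeometry.SemiGraphs.PSCEdgewiseCriterionProofs
import HarnessLib

/-!
# `β̄ : Π^unr of the pro-l shadow of G_U ⥲ Π^unr of the pro-l shadow of H_{βU}` over `β`, and the transfer of verticial filtration-preservation ([CombGC] Thm. 1.6 (iii), general `Σ`)

Mochizuki, *A combinatorial version of the Grothendieck conjecture*, Tohoku Math. J. **59** (2007)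
[CombGC], proof of Thm. 1.6, author's ms p. 13 l.−8…−4 ("we may assume that `Σ = {l}`") and (iii) p. 14;
row T16-L04c «(iii) general Σ» of the abc-iut sub-DAG `plan/L3/SUBDAG-CombGC-Thm16.md` (lineage
abc-iut-w4-d052).

At a `Π^unr_G`-covering datum `E` on a level `U ⊇ Ker` (`U' = β U`, datum `E'` on `U'`; e.g. the
`restrictBD` data) with presentations `g : U ↠ Q`, `g' : U' ↠ Q'` of the maximal pro-`l` quotients and
SHADOWS `D = E.mapAlong g`, `D' = E'.mapAlong g'` (abc-iut-L3-t4):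

* `exists_unrShadowEquiv` — an isomorphism of topological groups
  `ρ : Q / Ker(Q ↠ Π^unr_D) ≅ Q' / Ker(Q' ↠ Π^unr_{D'})` OVER `β` (`ρ [g x] = [g' x']` whenever
  `β [x] = [x']`), from `PSCUnrShadowEquiv` + `PSCUnrShadowKernel`;
* `unrShadow_transport_map` — the DICTIONARY: the transport along `ρ` of `g(X)` (`X ≤ U`) is
  `g'(X') · Ker`, where `X' ≤ U'` is the transport of `X` along `β` read inside `U'`;
* `IsUnrVerticiallyFiltrationPreserving.unrShadow` — if `β` is verticially filtration-preserving
  (Def. 1.4 (iii)), so is `ρ` (the missing `Π^unr`-analogue of abc-iut-L3-t4's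
  `IsVerticiallyFiltrationPreserving.mapAlong`; uses `mapAlong_vertFil_map` and the `M^vert`
  compatibility of the covering data, displayed as `hEv`, `hE'v`).

Proof-only, 0 defs; nothing here takes a side on [IUTchIII] Cor. 3.12. [cite: MochizukiCombGC2007, Thm 1.6(iii) p.13]
-/

namespace Literature.AnabelianGeometry.SemiGraphs

open scoped Pointwise

universe u

namespace PSCDatum

variable {P : Type u} [Group P] [TopologicalSpace P] [IsTopologicalGroup P]
variable {P' : Type u} [Group P'] [TopologicalSpace P'] [IsTopologicalGroup P']
variable (G : PSCDatum P) (H : PSCDatum P') (β : (P ⧸ G.unrKer) ≃ₜ* (P' ⧸ H.unrKer))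
variable {U : Subgroup P} [CompactSpace U] (hU : IsOpen (U : Set P)) (hKU : G.unrKer ≤ U)
  (E : PSCDatum U) (hE : E.unrKer.map U.subtype = G.unrKer)
variable {U' : Subgroup P'} [CompactSpace U'] (hU' : IsOpen (U' : Set P'))
  (E' : PSCDatum U') (hE' : E'.unrKer.map U'.subtype = H.unrKer) (hUU' : G.unrTransport H β U = U')
variable {Q : Type u} [Group Q] [TopologicalSpace Q] [IsTopologicalGroup Q] [CompactSpace Q]
  [TotallyDisconnectedSpace Q] [T2Space Q]
variable {Q' : Type u} [Group Q'] [TopologicalSpace Q'] [IsTopologicalGroup Q'] [CompactSpace Q']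
  [TotallyDisconnectedSpace Q'] [T2Space Q']
variable {l : ℕ} (hSl : ({l} : Set ℕ) ⊆ E.Sigma) (hSl' : ({l} : Set ℕ) ⊆ E'.Sigma)
  {g : U →* Q} (hg : IsMaxProSigmaQuotient {l} g) {g' : U' →* Q'} (hg' : IsMaxProSigmaQuotient {l} g')

/-! ### 1. The isomorphism `ρ` over `β` -/

include hU hKU hE hU' hE' hUU' in
/-- **`ρ : Q / Ker(Q ↠ Π^unr_D) ≅ Q' / Ker(Q' ↠ Π^unr_{D'})` over `β`** for the pro-`l` shadows `D`,
`D'` of `Π^unr`-covering data `E`, `E'` on the levels `U`, `U' = β U` — "the isomorphism induced by `β`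
between the maximal pro-`l` quotients of `Π^unr_{G_U} = U/Ker` and `Π^unr_{H_{U'}} = U'/Ker'`": an
isomorphism of topological groups with `ρ [g x] = [g' x']` whenever `β [x] = [x']`.
[cite: MochizukiCombGC2007, Thm 1.6(iii) p.13] -/
theorem exists_unrShadowEquiv :
    ∃ ρ : (Q ⧸ (E.mapAlong g hg.continuous {l} hSl (Set.singleton_nonempty l) hg.proSigma).unrKer) ≃ₜ*
        (Q' ⧸ (E'.mapAlong g' hg'.continuous {l} hSl' (Set.singleton_nonempty l) hg'.proSigma).unrKer),
      ∀ (x : U) (x' : U'),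
        β (QuotientGroup.mk (x : P)) = (QuotientGroup.mk (x' : P') : P' ⧸ H.unrKer) →
          ρ (QuotientGroup.mk (g x)) = QuotientGroup.mk (g' x') := by
  haveI : IsClosed (((E.mapAlong g hg.continuous {l} hSl (Set.singleton_nonempty l) hg.proSigma).unrKer :
      Subgroup Q) : Set Q) := Subgroup.isClosed_topologicalClosure _
  haveI : IsClosed (((E'.mapAlong g' hg'.continuous {l} hSl' (Set.singleton_nonempty l)
      hg'.proSigma).unrKer : Subgroup Q') : Set Q') := Subgroup.isClosed_topologicalClosure _
  obtain ⟨ρ, hρ⟩ := G.exists_equiv_over_unrTransport H β hUU'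
    ((QuotientGroup.mk' _).comp g) (QuotientGroup.continuous_mk.comp hg.continuous)
    ((QuotientGroup.mk'_surjective _).comp hg.surjective)
    ((QuotientGroup.mk' _).comp g') (QuotientGroup.continuous_mk.comp hg'.continuous)
    ((QuotientGroup.mk'_surjective _).comp hg'.surjective)
    (fun x x' h => G.ker_iff_of_unrTransport_map_ker H β _ _
      (G.unrKer_le_map_subtype_ker U E hE hSl hg)
      (G.unrTransport_map_subtype_ker H β hU hKU E hE hU' E' hE' hSl hSl' hg hg' hUU') x x' h)
  exact ⟨ρ, fun x x' h => hρ x x' h⟩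

/-! ### 2. The dictionary: transport along `ρ` vs transport along `β` -/

section Dictionary

variable (ρ : (Q ⧸ (E.mapAlong g hg.continuous {l} hSl (Set.singleton_nonempty l) hg.proSigma).unrKer) ≃ₜ*
    (Q' ⧸ (E'.mapAlong g' hg'.continuous {l} hSl' (Set.singleton_nonempty l) hg'.proSigma).unrKer))
  (hρ : ∀ (x : U) (x' : U'),
    β (QuotientGroup.mk (x : P)) = (QuotientGroup.mk (x' : P') : P' ⧸ H.unrKer) →
      ρ (QuotientGroup.mk (g x)) = QuotientGroup.mk (g' x'))

include hUU' hρ in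
omit [CompactSpace Q] [TotallyDisconnectedSpace Q] [CompactSpace Q'] [TotallyDisconnectedSpace Q'] in
/-- **The dictionary.**  For `X ≤ U`, the transport along `ρ` of `g(X)` is `g'(X') · Ker(Q' ↠ Π^unr_{D'})`,
where `X' ≤ U'` is the transport of `X` along `β` read inside `U'`.
[cite: MochizukiCombGC2007, Def 1.4(iii) p.10] -/
theorem unrShadow_transport_map (X : Subgroup U) :
    (E.mapAlong g hg.continuous {l} hSl (Set.singleton_nonempty l) hg.proSigma).unrTransport
        (E'.mapAlong g' hg'.continuous {l} hSl' (Set.singleton_nonempty l) hg'.proSigma) ρ (X.map g) =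
      ((G.unrTransport H β (X.map U.subtype)).comap U'.subtype).map g' ⊔
        (E'.mapAlong g' hg'.continuous {l} hSl' (Set.singleton_nonempty l) hg'.proSigma).unrKer := by
  set N := (E.mapAlong g hg.continuous {l} hSl (Set.singleton_nonempty l) hg.proSigma).unrKer with hN
  set N' := (E'.mapAlong g' hg'.continuous {l} hSl' (Set.singleton_nonempty l) hg'.proSigma).unrKer with hN'
  set X' : Subgroup U' := (G.unrTransport H β (X.map U.subtype)).comap U'.subtype with hX'
  -- the image of `g(X)` in `Q/N`, carried by `ρ`, is the image of `g'(X')` in `Q'/N'`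
  have key : ((X.map g).map (QuotientGroup.mk' N)).map ρ.toMulEquiv.toMonoidHom =
      (X'.map g').map (QuotientGroup.mk' N') := by
    apply le_antisymm
    · rintro _ ⟨_, ⟨_, ⟨x, hx, rfl⟩, rfl⟩, rfl⟩
      obtain ⟨x', hx'U, hxx'⟩ := G.exists_mem_unrTransport_mk_eq H β (x : P) x.2
      rw [hUU'] at hx'U
      refine ⟨g' ⟨x', hx'U⟩, ⟨⟨x', hx'U⟩, ?_, rfl⟩, ?_⟩
      · have hmem : (x' : P') ∈ G.unrTransport H β (X.map U.subtype) :=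
          (G.mem_unrTransport_iff H β).mpr ⟨x, ⟨x, hx, rfl⟩, hxx'⟩
        exact hmem
      · exact (hρ x ⟨x', hx'U⟩ hxx').symm
    · rintro _ ⟨_, ⟨x', hx', rfl⟩, rfl⟩
      have hx'' : (x' : P') ∈ G.unrTransport H β (X.map U.subtype) := hx'
      rw [G.mem_unrTransport_iff H β] at hx''
      obtain ⟨s, ⟨x, hx, rfl⟩, hsx'⟩ := hx''
      exact ⟨QuotientGroup.mk (g x), ⟨g x, ⟨x, hx, rfl⟩, rfl⟩, hρ x x' hsx'⟩
  unfold unrTransport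
  rw [key, Subgroup.comap_map_eq, QuotientGroup.ker_mk']

include hUU' in
omit [CompactSpace U] [CompactSpace U'] in
/-- The transport of `X ≤ U` read inside `U'`, pushed back into `Π_H`, is the transport of `X`.
[cite: MochizukiCombGC2007, Def 1.4(iii) p.10] -/
theorem map_subtype_comap_unrTransport (X : Subgroup U) :
    ((G.unrTransport H β (X.map U.subtype)).comap U'.subtype).map U'.subtype =
      G.unrTransport H β (X.map U.subtype) := by
  refine Subgroup.map_comap_eq_self ?_
  rw [Subgroup.range_subtype, ← hUU']
  exact G.unrTransport_mono H β (Subgroup.map_subtype_le X)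

end Dictionary

/-! ### 3. Verticial filtration-preservation passes to the shadows -/

include hU hKU hE hU' hE' hUU' in
/-- **If `β` is verticially filtration-preserving (Def. 1.4 (iii)), so is `ρ`** between the `Π^unr`'s of
the pro-`l` shadows: at a level `V ⊇ Ker` of `D`, `V = g(W)` with `W = g⁻¹ V` a level of `E` above the
kernel, `M^vert` of `D` at `V` is `g(M^vert of E at W)` (`mapAlong_vertFil_map`), `M^vert` of `E` at
`W` is that of `G` at `W ⊆ Π_G` (displayed as `hEv`; `map_subtype_vertFil_restrictBD` for the covering
data), `β` carries it to `M^vert` of `H` at `β W`, and back up through `E'`, `g'`.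
[cite: MochizukiCombGC2007, Thm 1.6(iii) p.13] -/
theorem IsUnrVerticiallyFiltrationPreserving.unrShadow (hβ : G.IsUnrVerticiallyFiltrationPreserving H β)
    (hEv : ∀ X : Subgroup U, (E.vertFil X).map U.subtype = G.vertFil (X.map U.subtype))
    (hE'v : ∀ X' : Subgroup U', (E'.vertFil X').map U'.subtype = H.vertFil (X'.map U'.subtype))
    (ρ : (Q ⧸ (E.mapAlong g hg.continuous {l} hSl (Set.singleton_nonempty l) hg.proSigma).unrKer) ≃ₜ*
      (Q' ⧸ (E'.mapAlong g' hg'.continuous {l} hSl' (Set.singleton_nonempty l) hg'.proSigma).unrKer))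
    (hρ : ∀ (x : U) (x' : U'),
      β (QuotientGroup.mk (x : P)) = (QuotientGroup.mk (x' : P') : P' ⧸ H.unrKer) →
        ρ (QuotientGroup.mk (g x)) = QuotientGroup.mk (g' x')) :
    (E.mapAlong g hg.continuous {l} hSl (Set.singleton_nonempty l) hg.proSigma).IsUnrVerticiallyFiltrationPreserving
      (E'.mapAlong g' hg'.continuous {l} hSl' (Set.singleton_nonempty l) hg'.proSigma) ρ := by
  have hN : (E.mapAlong g hg.continuous {l} hSl (Set.singleton_nonempty l) hg.proSigma).unrKer =
      E.unrKer.map g := E.mapAlong_unrKer g hg.continuous hg.surjective {l} _ _ hg.proSigma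
  have hN' : (E'.mapAlong g' hg'.continuous {l} hSl' (Set.singleton_nonempty l) hg'.proSigma).unrKer =
      E'.unrKer.map g' := E'.mapAlong_unrKer g' hg'.continuous hg'.surjective {l} _ _ hg'.proSigma
  intro V hVo hNV
  -- the level `W = g⁻¹ V` of `E`
  set W : Subgroup U := V.comap g with hW
  have hWV : W.map g = V := Subgroup.map_comap_eq_self_of_surjective hg.surjective _
  have hkerW : g.ker ≤ W := by rw [hW, ← MonoidHom.comap_bot]; exact Subgroup.comap_mono bot_le
  have hEW : E.unrKer ≤ W := by
    intro k hk
    rw [hW, Subgroup.mem_comap]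
    exact hNV (hN ▸ ⟨k, hk, rfl⟩)
  have hWo : IsOpen (W : Set U) := hVo.preimage hg.continuous
  -- its image `W↑` in `Π_G`, a level of `G`
  have hWPo : IsOpen ((W.map U.subtype : Subgroup P) : Set P) := by
    rw [Subgroup.coe_map, Subgroup.coe_subtype]; exact hU.isOpenMap_subtype_val _ hWo
  have hKW : G.unrKer ≤ W.map U.subtype := hE ▸ Subgroup.map_mono hEW
  -- the transported level `W'` of `E'`
  set W' : Subgroup U' := (G.unrTransport H β (W.map U.subtype)).comap U'.subtype with hW'
  have hW'P : W'.map U'.subtype = G.unrTransport H β (W.map U.subtype) :=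
    G.map_subtype_comap_unrTransport H β hUU' W
  -- `W'` contains the kernel of `U' ↠ Q' ↠ Q'/Ker`
  have hkerφW' : ((QuotientGroup.mk' (E'.mapAlong g' hg'.continuous {l} hSl' (Set.singleton_nonempty l)
      hg'.proSigma).unrKer).comp g').ker ≤ W' := by
    intro y hy
    have hyP : (y : P') ∈ (((QuotientGroup.mk' (E'.mapAlong g' hg'.continuous {l} hSl'
        (Set.singleton_nonempty l) hg'.proSigma).unrKer).comp g').ker).map U'.subtype := ⟨y, hy, rfl⟩
    rw [← G.unrTransport_map_subtype_ker H β hU hKU E hE hU' E' hE' hSl hSl' hg hg' hUU'] at hyP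
    change (y : P') ∈ G.unrTransport H β (W.map U.subtype)
    refine G.unrTransport_mono H β ?_ hyP
    rw [E.ker_mk_comp_eq g hg.continuous hg.surjective {l} _ _ hg.proSigma]
    exact Subgroup.map_mono (sup_le hEW hkerW)
  have hkerW' : g'.ker ≤ W' := by
    refine le_trans ?_ hkerφW'
    rw [← MonoidHom.comap_ker]; exact Subgroup.comap_mono bot_le
  have hE'W' : E'.unrKer ≤ W' := by
    refine le_trans ?_ hkerφW'
    rw [E'.ker_mk_comp_eq g' hg'.continuous hg'.surjective {l} _ _ hg'.proSigma]
    exact le_sup_left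
  -- LHS: `ρ`-transport of `M^vert_D(V) = g(M^vert_E(W))`
  have h1 : (E.mapAlong g hg.continuous {l} hSl (Set.singleton_nonempty l) hg.proSigma).vertFil V =
      (E.vertFil W).map g := by
    rw [← hWV]
    exact E.mapAlong_vertFil_map g hg.continuous {l} hSl (Set.singleton_nonempty l) hg.proSigma
      hg.surjective hkerW
  have h2 : (G.unrTransport H β ((E.vertFil W).map U.subtype)).comap U'.subtype = E'.vertFil W' := by
    rw [hEv W, hβ _ hWPo hKW, ← hW'P, ← hE'v W',
      Subgroup.comap_map_eq_self_of_injective U'.subtype_injective]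
  rw [h1, G.unrShadow_transport_map H β E E' hUU' hSl hSl' hg hg' ρ hρ (E.vertFil W), h2]
  -- RHS: `M^vert_{D'}` at the `ρ`-transport of `V = g(W)`, which is `g'(W')`
  have h3 : (E.mapAlong g hg.continuous {l} hSl (Set.singleton_nonempty l) hg.proSigma).unrTransport
      (E'.mapAlong g' hg'.continuous {l} hSl' (Set.singleton_nonempty l) hg'.proSigma) ρ V = W'.map g' := by
    rw [← hWV, G.unrShadow_transport_map H β E E' hUU' hSl hSl' hg hg' ρ hρ W, ← hW', hN', sup_eq_left]
    exact Subgroup.map_mono hE'W'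
  rw [h3]
  have h4 : (E'.mapAlong g' hg'.continuous {l} hSl' (Set.singleton_nonempty l) hg'.proSigma).vertFil
      (W'.map g') = (E'.vertFil W').map g' :=
    E'.mapAlong_vertFil_map g' hg'.continuous {l} hSl' (Set.singleton_nonempty l) hg'.proSigma
      hg'.surjective hkerW'
  rw [h4, sup_eq_left, ← h4]
  -- `Ker(Q' ↠ Π^unr_{D'}) ⊆ M^vert_{D'}` at a level containing it
  refine (E'.mapAlong g' hg'.continuous {l} hSl' (Set.singleton_nonempty l) hg'.proSigma).unrKer_le_vertFil ?_
  rw [hN']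
  exact Subgroup.map_mono hE'W'

end PSCDatum

end Literature.AnabelianGeometry.SemiGraphs
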